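import Summits.FinalStateConjecture.FinalStateConjecture.Theorems.EIHFluxBalanceInertialRecessionProfiles
import Mathlib.MeasureTheory.Integral.DominatedConvergence
import Mathlib.MeasureTheory.Integral.IntervalIntegral.Basic

/-!
# Route EIHFluxBalance — `InertialRecession`, re-charting: meshing the certified radii with the
# flat-ball profile (monotone certified radii, continuous minorants, eventual inequalities)

Helper file for the crux `stmt-FinalStateConjecture-10166`
(`Summit.FinalStateConjecture.FinalStateConjecture.Theses.EIHFluxBalance.InertialRecession`),
stub `stub_rechart` (the transfer P2 of line `sublinear-is-free-clean-window-charges`).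

The causal transfer (file `…RechartTransfer`) needs, besides the charts, three families of
radii that mesh: MONOTONE certified near-zone radii `Rᵢ(τ) → ∞` along which the hole charts still
converge (any minorant of the diagonal radius of `exists_growing_radius` will do — monotonicity of
`truncDeviationCk` in the radius); a CONTINUOUS flat-ball profile `R′(t) → ∞`, `R′(t)/t → 0`
(input of `flat_radiationZone_package_of_profile`); and the inequalities, after some time `T`,
`2C R′(t) ≤ ρᵢ(t)` (ball points are honest), `C R′(t) ≤ Rᵢ(αᵢt/2)` (ball points are certified at
their hole time `≥ αᵢt/2`), `βᵢC R′(t) ≤ αᵢt/2`, `βᵢC R′(t) ≤ (1 − αᵢ)t` (hole time of ball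
points on the lab slab `t` is `≤ t`), `Kᵢ ≤ Rᵢ(αᵢt/2)`. This file produces them:

* `exists_monotone_minorant` — a function `R → ∞` bounded below has a monotone minorant `→ ∞`
  (the running infimum `τ ↦ inf R([τ, ∞))`);
* `exists_continuous_minorant` — a monotone `h → ∞` has a continuous minorant `→ ∞`
  (`t ↦ ∫_{t−1}^{t} h`);
* `exists_meshed_radii` — the package above (via the landed `exists_meshing_profile`).

[folklore real analysis]
-/

noncomputable section

set_option linter.dupNamespace false

open Set Filter Topology MeasureTheory intervalIntegral

namespace Summit.FinalStateConjecture.FinalStateConjecture.Theorems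

/-! ### Monotone and continuous minorants -/

/-- **Monotone minorant.** A function `R : ℝ → ℝ` tending to `+∞` and bounded below by `b` has a
monotone minorant tending to `+∞`: the running infimum `Ř(τ) = inf R([τ, ∞))`. [folklore] -/
theorem exists_monotone_minorant {R : ℝ → ℝ} {b : ℝ} (hb : ∀ t, b ≤ R t)
    (hR : Tendsto R atTop atTop) :
    ∃ Rm : ℝ → ℝ, Monotone Rm ∧ Tendsto Rm atTop atTop ∧ ∀ t, Rm t ≤ R t := by
  have hbdd : ∀ τ, BddBelow (R '' Ici τ) := fun τ ↦ ⟨b, by rintro _ ⟨t, -, rfl⟩; exact hb t⟩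
  have hne : ∀ τ, (R '' Ici τ).Nonempty := fun τ ↦ ⟨R τ, τ, self_mem_Ici, rfl⟩
  refine ⟨fun τ ↦ sInf (R '' Ici τ), fun τ₁ τ₂ h ↦ ?_, ?_, fun t ↦ ?_⟩
  · exact csInf_le_csInf (hbdd τ₁) (hne τ₂) (image_mono (Ici_subset_Ici.mpr h))
  · refine tendsto_atTop.2 fun c ↦ ?_
    obtain ⟨T, hT⟩ := eventually_atTop.1 (tendsto_atTop.1 hR c)
    filter_upwards [eventually_ge_atTop T] with τ hτ
    refine le_csInf (hne τ) ?_
    rintro _ ⟨t, ht, rfl⟩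
    exact hT t (hτ.trans ht)
  · exact csInf_le (hbdd t) ⟨t, self_mem_Ici, rfl⟩

/-- **Continuous minorant.** A monotone function `h : ℝ → ℝ` tending to `+∞` has a continuous
minorant tending to `+∞`: `t ↦ ∫_{t−1}^{t} h` (between `h(t − 1)` and `h(t)`). [folklore] -/
theorem exists_continuous_minorant {h : ℝ → ℝ} (hm : Monotone h) (ht : Tendsto h atTop atTop) :
    ∃ g : ℝ → ℝ, Continuous g ∧ Tendsto g atTop atTop ∧ ∀ t, g t ≤ h t := by
  have hint : ∀ a b : ℝ, IntervalIntegrable h volume a b := fun a b ↦ hm.intervalIntegrable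
  set F : ℝ → ℝ := fun t ↦ ∫ s in (0 : ℝ)..t, h s with hF
  have hFc : Continuous F := continuous_primitive hint 0
  have hsplit : ∀ t, F t - F (t - 1) = ∫ s in (t - 1)..t, h s := by
    intro t
    rw [hF]
    simp only
    rw [sub_eq_iff_eq_add', integral_add_adjacent_intervals (hint 0 (t - 1)) (hint (t - 1) t)]
  refine ⟨fun t ↦ F t - F (t - 1), hFc.sub (hFc.comp (continuous_id.sub continuous_const)), ?_,
    fun t ↦ ?_⟩
  · -- `g t ≥ h (t - 1) → ∞`
    have hlow : ∀ t, h (t - 1) ≤ F t - F (t - 1) := by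
      intro t
      rw [hsplit]
      have h1 : ∫ s in (t - 1)..t, (fun _ ↦ h (t - 1)) s ≤ ∫ s in (t - 1)..t, h s :=
        integral_mono_on (by linarith) (by simp) (hint _ _) fun s hs ↦ hm hs.1
      simpa using h1
    refine tendsto_atTop_mono hlow ?_
    exact ht.comp (tendsto_atTop_add_const_right _ _ tendsto_id)
  · show F t - F (t - 1) ≤ h t
    rw [hsplit]
    have h1 : ∫ s in (t - 1)..t, h s ≤ ∫ s in (t - 1)..t, (fun _ ↦ h t) s :=
      integral_mono_on (by linarith) (hint _ _) (by simp) fun s hs ↦ hm hs.2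
    simpa using h1

/-! ### The meshed radii -/

/-- **Meshed radii for the re-charted decomposition.** Given, for `N ≥ 1` holes, diagonal
certified radii `Rdᵢ → ∞` bounded below by `0`, continuous excision profiles `ρᵢ → ∞`, a
painted-radius factor `C ≥ 1`, dictionary constants `αᵢ ∈ (0, 1]`, `βᵢ ≥ 0` with `βᵢ = 0` whenever
`αᵢ = 1`, loitering radii `Kᵢ` and a floor `R₀`, there are MONOTONE certified radii `Rᵢ ≤ Rdᵢ`,
`Rᵢ → ∞`, a CONTINUOUS flat-ball profile `R′ ≥ R₀` with `R′ → ∞`, `R′(t)/t → 0`, and a time `T`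
after which `2C R′ ≤ ρᵢ`, `C R′(t) ≤ Rᵢ(αᵢt/2)`, `βᵢC R′(t) ≤ αᵢt/2`, `βᵢC R′(t) ≤ (1 − αᵢ)t` and
`Kᵢ ≤ Rᵢ(αᵢt/2)` for every `i` (`βᵢ ≥ 0` is not even needed). [folklore] -/
theorem exists_meshed_radii {N : ℕ} (i₀ : Fin N) (Rd ρ : Fin N → ℝ → ℝ)
    (hRd0 : ∀ i t, 0 ≤ Rd i t) (hRdt : ∀ i, Tendsto (Rd i) atTop atTop)
    (hρc : ∀ i, Continuous (ρ i)) (hρt : ∀ i, Tendsto (ρ i) atTop atTop)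
    {C : ℝ} (hC : 1 ≤ C) (α β K : Fin N → ℝ) (hα0 : ∀ i, 0 < α i) (hα1 : ∀ i, α i ≤ 1)
    (hαβ : ∀ i, α i = 1 → β i = 0) (R₀ : ℝ) :
    ∃ (R : Fin N → ℝ → ℝ) (R' : ℝ → ℝ), (∀ i, Monotone (R i)) ∧ (∀ i t, R i t ≤ Rd i t) ∧
      (∀ i, Tendsto (R i) atTop atTop) ∧ Continuous R' ∧ (∀ t, R₀ ≤ R' t) ∧
      Tendsto R' atTop atTop ∧ Tendsto (fun t ↦ R' t / t) atTop (𝓝 0) ∧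
      ∃ T : ℝ, ∀ t, T ≤ t → ∀ i, 2 * C * R' t ≤ ρ i t ∧ C * R' t ≤ R i (α i * t / 2) ∧
        β i * C * R' t ≤ α i * t / 2 ∧ β i * C * R' t ≤ (1 - α i) * t ∧
        K i ≤ R i (α i * t / 2) := by
  have hC0 : 0 < C := by linarith
  -- monotone certified radii
  choose R hRm hRt hRle using fun i ↦ exists_monotone_minorant (hRd0 i) (hRdt i)
  -- continuous minorants of `t ↦ R i (α i t / 2) / C`
  have hmono : ∀ i, Monotone fun t ↦ R i (α i * t / 2) / C := fun i t₁ t₂ h ↦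
    div_le_div_of_nonneg_right (hRm i (by nlinarith [hα0 i])) hC0.le
  have hlin : ∀ i, Tendsto (fun t ↦ α i * t / 2) atTop atTop := fun i ↦
    (tendsto_id.const_mul_atTop (half_pos (hα0 i))).congr fun t ↦ by simp only [id]; ring
  have htend : ∀ i, Tendsto (fun t ↦ R i (α i * t / 2) / C) atTop atTop := fun i ↦
    Tendsto.atTop_div_const hC0 ((hRt i).comp (hlin i))
  choose g hgc hgt hgle using fun i ↦ exists_continuous_minorant (hmono i) (htend i)
  -- feed `min (ρ i / (2C)) (g i)` to the meshing profile
  have hmc : ∀ i, Continuous fun t ↦ min (ρ i t / (2 * C)) (g i t) := fun i ↦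
    ((hρc i).div_const (2 * C)).min (hgc i)
  have hmt : ∀ i, Tendsto (fun t ↦ min (ρ i t / (2 * C)) (g i t)) atTop atTop := by
    intro i
    refine tendsto_atTop.2 fun b ↦ ?_
    filter_upwards [tendsto_atTop.1 (Tendsto.atTop_div_const (by positivity : (0 : ℝ) < 2 * C)
      (hρt i)) b, tendsto_atTop.1 (hgt i) b] with t h1 h2
    exact le_min h1 h2
  obtain ⟨R', hR'c, hR'0, hR't, hR'd, T₁, hT₁⟩ :=
    exists_meshing_profile' i₀ (fun i t ↦ min (ρ i t / (2 * C)) (g i t)) hmc hmt (max R₀ 0)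
  have hR'0' : ∀ t, R₀ ≤ R' t := fun t ↦ (le_max_left _ _).trans (hR'0 t)
  have hR'nn : ∀ t, 0 ≤ R' t := fun t ↦ (le_max_right _ _).trans (hR'0 t)
  -- the remaining eventual inequalities
  have hev : ∀ i, ∀ᶠ t in atTop, β i * C * R' t ≤ α i * t / 2 ∧ β i * C * R' t ≤ (1 - α i) * t ∧
      K i ≤ R i (α i * t / 2) := by
    intro i
    have hK : ∀ᶠ t in atTop, K i ≤ R i (α i * t / 2) :=
      ((hRt i).comp (hlin i)).eventually (eventually_ge_atTop (K i))
    rcases eq_or_lt_of_le (hα1 i) with h1 | h1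
    · have hβ0 : β i = 0 := hαβ i h1
      filter_upwards [hK, eventually_ge_atTop (0 : ℝ)] with t hKt ht
      refine ⟨?_, ?_, hKt⟩
      · rw [hβ0, zero_mul, zero_mul]; nlinarith [hα0 i]
      · rw [hβ0, zero_mul, zero_mul, h1]; simp
    · -- `β C R′(t)/t → 0`
      have hsmall : Tendsto (fun t ↦ β i * C * (R' t / t)) atTop (𝓝 0) := by
        simpa using hR'd.const_mul (β i * C)
      have e1 : ∀ᶠ t in atTop, β i * C * (R' t / t) ≤ α i / 2 :=
        (tendsto_order.1 hsmall).2 _ (by nlinarith [hα0 i]) |>.mono fun t ht ↦ ht.le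
      have e2 : ∀ᶠ t in atTop, β i * C * (R' t / t) ≤ 1 - α i :=
        (tendsto_order.1 hsmall).2 _ (by linarith) |>.mono fun t ht ↦ ht.le
      filter_upwards [hK, e1, e2, eventually_gt_atTop (0 : ℝ)] with t hKt h1t h2t ht
      have hr : β i * C * R' t = β i * C * (R' t / t) * t := by field_simp
      refine ⟨?_, ?_, hKt⟩
      · rw [hr]; nlinarith
      · rw [hr]; nlinarith
  obtain ⟨T₂, hT₂⟩ := eventually_atTop.1 (eventually_all.2 hev)
  refine ⟨R, R', hRm, hRle, hRt, hR'c, hR'0', hR't, hR'd, max T₁ T₂, fun t ht i ↦ ?_⟩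
  have ht1 : T₁ ≤ t := (le_max_left _ _).trans ht
  have ht2 : T₂ ≤ t := (le_max_right _ _).trans ht
  obtain ⟨h3, h4, h5⟩ := hT₂ t ht2 i
  have hmin := hT₁ t ht1 i
  refine ⟨?_, ?_, h3, h4, h5⟩
  · -- `2 C R′ ≤ ρ`
    have : 4 * R' t ≤ ρ i t / (2 * C) := hmin.trans (min_le_left _ _)
    rw [le_div_iff₀ (by positivity)] at this
    nlinarith [hR'nn t, hC0]
  · -- `C R′(t) ≤ R i (α t / 2)`
    have h6 : 4 * R' t ≤ R i (α i * t / 2) / C := (hmin.trans (min_le_right _ _)).trans (hgle i t)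
    rw [le_div_iff₀ hC0] at h6
    nlinarith [hR'nn t, hC0]

/-- Registered one-line form (stub `exists_meshed_radii_rechart` of the crux item) of
`exists_meshed_radii`. [folklore] -/
theorem exists_meshed_radii_rechart : open Filter Topology in ∀ {N : ℕ}, Fin N → ∀ (Rd ρ : Fin N → ℝ → ℝ), (∀ i t, 0 ≤ Rd i t) → (∀ i, Tendsto (Rd i) atTop atTop) → (∀ i, Continuous (ρ i)) → (∀ i, Tendsto (ρ i) atTop atTop) → ∀ {C : ℝ}, 1 ≤ C → ∀ (α β K : Fin N → ℝ), (∀ i, 0 < α i) → (∀ i, α i ≤ 1) → (∀ i, α i = 1 → β i = 0) → ∀ R₀ : ℝ, ∃ (R : Fin N → ℝ → ℝ) (R' : ℝ → ℝ), (∀ i, Monotone (R i)) ∧ (∀ i t, R i t ≤ Rd i t) ∧ (∀ i, Tendsto (R i) atTop atTop) ∧ Continuous R' ∧ (∀ t, R₀ ≤ R' t) ∧ Tendsto R' atTop atTop ∧ Tendsto (fun t ↦ R' t / t) atTop (𝓝 0) ∧ ∃ T : ℝ, ∀ t, T ≤ t → ∀ i, 2 * C * R' t ≤ ρ i t ∧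 C * R' t ≤ R i (α i * t / 2) ∧ β i * C * R' t ≤ α i * t / 2 ∧ β i * C * R' t ≤ (1 - α i) * t ∧ K i ≤ R i (α i * t / 2) :=
  fun i₀ Rd ρ hRd0 hRdt hρc hρt _ hC α β K hα0 hα1 hαβ R₀ ↦
    exists_meshed_radii i₀ Rd ρ hRd0 hRdt hρc hρt hC α β K hα0 hα1 hαβ R₀

end Summit.FinalStateConjecture.FinalStateConjecture.Theorems

end
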